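import Summits.BirchSwinnertonDyer.BirchSwinnertonDyer.Theorems.ManinLocalTwoThreePShiftTransfer
import HarnessLib

/-!
# The prime-generic transfer step, II: `p`-shift eigencharacters, the compatible pair at a level prime to `p`, conjugation invariance
# (route `ManinLocalTwoThree`, cell bsd-f2-manin; cruxes C2 stmt-BirchSwinnertonDyer-22967 / C3 stmt-…-22968; LEAD seat p1 gen 12;
# the «odd → p·odd» step of the prime-generic shift-equaliser conjecture, HOME/p1/CENSUS-shift-equaliser-p1-g11.md)

The `p`-GENERIC form of `…CubeStepPair.lean` §2–§3 (p3, `p = 3`) / `…TwoShiftTransferPair.lean` (this seat, `p = 2`), for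
coefficients in ANY commutative ring `K` and ANY eigenvalue `ε`.  Level `M` with `p ∤ M`, `G = Γ₀(M)` acting on `P¹(𝔽_p)`
(`…PShiftTransfer.lean`):
* §0 the predicate `IsShiftEigenP p ε φ` — `φ(a, p b; c, d) = ε·φ(a, b; p c, d)` for every `(a b; pc d) ∈ Γ₀(pN)` — i.e. `φ` is an
  `ε`-eigenfunction of the `p`-shift `γ ↦ diag(p,1) γ diag(p,1)⁻¹` (`ε = 1`: `p`-shift invariant; p3's `TwoShift.IsShiftEigen` is the
  case `p = 2`, the typer's `IsThreeShiftInvariant` / `IsThreeShiftAntiInvariant` the cases `(3, ±1)`), and the single-level schemas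
  `ShiftInvariantIsDiamondAtP p N`, `ShiftEigenTrivialAtP p N ε`;
* §1 for `φ : Γ₀(pM) → K` additive with `IsShiftEigenP p ε φ`: the coshift character `coshift φ ε = ε·φ(a, b/p; p c, d)` is additive
  on `stabZero`, the restriction `restr φ` is additive on `stabInf`, and they AGREE on `stabZero ∩ stabInf` (`coshift_eq_restr`);
* §2 `Γ₀(M) = T^v · stabZero · T^{-u}` pointwise, hence `ρ = restr φ` on `kerAct` is invariant under conjugation by all of `Γ₀(M)`
  (`restr_conj`); and `stabInf = (stabZero ∩ stabInf) · ⟨T⟩` (`exists_stab_mul_Tpow`).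
Nothing about BSD, Manin's conjecture, C2/C3 or the equaliser laws is asserted here.  Reference: MEMO-es §37.9 (the `p = 3` original)
[cite: DarmonDiamondTaylor1995, Lemma 4.28 (p. 135) (shape: degeneracy maps on `Γ₀`)].
-/

set_option autoImplicit false
set_option linter.dupNamespace false

open scoped MatrixGroups

open CongruenceSubgroup Matrix.SpecialLinearGroup
  Summit.BirchSwinnertonDyer.Rank1Residual.ManinAdditive.NineShiftEqualiser

namespace Summit.BirchSwinnertonDyer.BirchSwinnertonDyer.Theorems.ManinLocalTwoThree

namespace PShiftTransfer

open ThreeShiftDescent TwoShift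

/-! ### §0. `p`-shift eigencharacters and the single-level schemas -/

section Vocabulary

variable {K : Type*} [CommRing K]

/-- `φ : Γ₀(N) → K` is an `ε`-EIGENFUNCTION OF THE `p`-SHIFT: `φ(a, p b; c, d) = ε·φ(a, b; p c, d)` for every
`(a b; pc d) ∈ Γ₀(pN)`, i.e. `π_p^* φ = ε·π_1^* φ` on `Γ₀(pN)`. [folklore] -/
def IsShiftEigenP (p : ℕ) {N : ℕ} (ε : K) (φ : Gamma0 N → K) : Prop :=
  ∀ (a b c d : ℤ) (hdet : a * d - b * (p * c) = 1) (hc : (N : ℤ) ∣ c),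
    φ (g0Of a (p * b) c d (by linear_combination hdet) hc)
      = ε * φ (g0Of a b (p * c) d hdet (Dvd.dvd.mul_left hc p))

/-- single-level schema: every additive `p`-shift-invariant `φ : Γ₀(N) → K` is a diamond class (`K_p(N) = D(N)` over `K`). [folklore] -/
def ShiftInvariantIsDiamondAtP (p N : ℕ) (K : Type*) [CommRing K] : Prop :=
  ∀ φ : Gamma0 N → K, IsAdd φ → IsShiftEigenP p (1 : K) φ → IsDiamond φ

/-- single-level schema: every additive `ε`-eigenfunction `Γ₀(N) → K` of the `p`-shift vanishes. [folklore] -/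
def ShiftEigenTrivialAtP (p N : ℕ) (ε : K) : Prop :=
  ∀ φ : Gamma0 N → K, IsAdd φ → IsShiftEigenP p ε φ → ∀ γ : Gamma0 N, φ γ = 0

/-- At `p = 2` the predicate is p3's `TwoShift.IsShiftEigen`. [folklore] -/
theorem isShiftEigenP_two_iff {N : ℕ} (ε : K) (φ : Gamma0 N → K) : IsShiftEigenP 2 ε φ ↔ IsShiftEigen ε φ :=
  Iff.rfl

end Vocabulary

/-! ### §1. The compatible pair `(coshift φ ε, restr φ)` -/

section Pair

variable {p : ℕ} [Fact p.Prime] {K : Type*} [CommRing K] {M : ℕ}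

omit [Fact p.Prime] in
/-- `p ≠ 0` as an integer. [folklore] -/
theorem p_ne_zero_int [hp : Fact p.Prime] : (p : ℤ) ≠ 0 := by exact_mod_cast hp.out.ne_zero

/-- **The coshift value** `ε·φ(a, b/p; p c, d)` of `γ = (a b; c d) ∈ Γ₀(M)` when `p ∣ b` (junk `0` otherwise).
[folklore] -/
noncomputable def coshift (φ : Gamma0 (p * M) → K) (ε : K) (γ : Gamma0 M) : K :=
  if h : (p : ℤ) ∣ ((γ : SL(2, ℤ)) 0 1 : ℤ) then
    ε * φ (g0Of ((γ : SL(2, ℤ)) 0 0) (((γ : SL(2, ℤ)) 0 1 : ℤ) / p) (p * (γ : SL(2, ℤ)) 1 0) ((γ : SL(2, ℤ)) 1 1)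
      (by
        have hq : ((γ : SL(2, ℤ)) 0 1 : ℤ) / p * p = (γ : SL(2, ℤ)) 0 1 := Int.ediv_mul_cancel h
        linear_combination gamma0_det_entries γ - ((γ : SL(2, ℤ)) 1 0 : ℤ) * hq)
      (dvd_p_mul' ((ZMod.intCast_zmod_eq_zero_iff_dvd _ _).mp (Gamma0_mem.mp γ.2))))
  else 0

/-- `coshift` on an explicit matrix `(a, p b; c, d)`: `ε·φ(a, b; p c, d)`. [folklore] -/
theorem coshift_g0Of (φ : Gamma0 (p * M) → K) (ε : K) (a b c d : ℤ) (h : a * d - (p * b) * c = 1)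
    (hc : (M : ℤ) ∣ c) (h' : a * d - b * (p * c) = 1) (hc' : ((p * M : ℕ) : ℤ) ∣ p * c) :
    coshift φ ε (g0Of a (p * b) c d h hc) = ε * φ (g0Of a b (p * c) d h' hc') := by
  unfold coshift
  rw [dif_pos (show (p : ℤ) ∣ (((g0Of a (p * b) c d h hc : Gamma0 M) : SL(2, ℤ)) 0 1 : ℤ) from ⟨b, rfl⟩)]
  congr 2
  exact g0Of_congr rfl (by show (p * b) / p = b; exact Int.mul_ediv_cancel_left b p_ne_zero_int) rfl rfl _ _ _ _

/-- **The restriction value** `φ(γ)` for `γ ∈ Γ₀(M)` with `pM ∣ c` (junk `0` otherwise). [folklore] -/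
noncomputable def restr (φ : Gamma0 (p * M) → K) (γ : Gamma0 M) : K :=
  if h : ((p * M : ℕ) : ℤ) ∣ ((γ : SL(2, ℤ)) 1 0 : ℤ) then
    φ (g0Of ((γ : SL(2, ℤ)) 0 0) ((γ : SL(2, ℤ)) 0 1) ((γ : SL(2, ℤ)) 1 0) ((γ : SL(2, ℤ)) 1 1) (gamma0_det_entries γ) h)
  else 0

omit [Fact p.Prime] in
/-- `restr` on an explicit matrix with `pM ∣ c`. [folklore] -/
theorem restr_g0Of (φ : Gamma0 (p * M) → K) (a b c d : ℤ) (h : a * d - b * c = 1)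
    (hc : (M : ℤ) ∣ c) (hc' : ((p * M : ℕ) : ℤ) ∣ c) :
    restr φ (g0Of a b c d h hc) = φ (g0Of a b c d h hc') := by
  unfold restr
  rw [dif_pos (show ((p * M : ℕ) : ℤ) ∣ (((g0Of a b c d h hc : Gamma0 M) : SL(2, ℤ)) 1 0 : ℤ) from hc')]
  rfl

variable (φ : Gamma0 (p * M) → K) (ε : K)

/-- `coshift φ ε` is additive on `stabZero`, for additive `φ`. [folklore] -/
theorem coshift_add (hadd : IsAdd φ) :
    ∀ x ∈ stabZero p M, ∀ y ∈ stabZero p M, coshift φ ε (x * y) = coshift φ ε x + coshift φ ε y := by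
  intro x hx y hy
  obtain ⟨a, b, c, d, h, hc, rfl⟩ := exists_eq_of_mem_stabZero hx
  obtain ⟨a', b', c', d', h', hc', rfl⟩ := exists_eq_of_mem_stabZero hy
  have hcp : (M : ℤ) ∣ c * a' + d * c' := dvd_add (Dvd.dvd.mul_right hc _) (Dvd.dvd.mul_left hc' _)
  have hprod : (g0Of a (p * b) c d h hc * g0Of a' (p * b') c' d' h' hc' : Gamma0 M) =
      g0Of (a * a' + (p * b) * c') (p * (a * b' + b * d')) (c * a' + d * c') (c * (p * b') + d * d')
        (by linear_combination (det_mul_entries h h')) hcp := by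
    rw [g0Of_mul a (p * b) c d a' (p * b') c' d' h hc h' hc' (det_mul_entries h h') hcp]
    exact g0Of_congr rfl (by ring) rfl rfl _ _ _ _
  have hcp' : ((p * M : ℕ) : ℤ) ∣ p * c * a' + d * (p * c') := by
    have := dvd_p_mul' (p := p) hcp
    have e : (p : ℤ) * (c * a' + d * c') = p * c * a' + d * (p * c') := by ring
    rwa [e] at this
  rw [hprod, coshift_g0Of φ ε _ _ _ _ _ _ (by linear_combination (det_mul_entries h h')) (dvd_p_mul' hcp),
    coshift_g0Of φ ε a b c d h hc (by linear_combination h) (dvd_p_mul' hc),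
    coshift_g0Of φ ε a' b' c' d' h' hc' (by linear_combination h') (dvd_p_mul' hc'), ← mul_add, ← hadd,
    g0Of_mul a b (p * c) d a' b' (p * c') d' _ _ _ _ (det_mul_entries (by linear_combination h)
      (by linear_combination h')) hcp']
  congr 2
  exact g0Of_congr (by ring) (by ring) (by ring) (by ring) _ _ _ _

/-- `restr φ` is additive on `stabInf`, for additive `φ`. [folklore] -/
theorem restr_add (hpM : ¬ p ∣ M) (hadd : IsAdd φ) :
    ∀ x ∈ stabInf p M, ∀ y ∈ stabInf p M, restr φ (x * y) = restr φ x + restr φ y := by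
  intro x hx y hy
  obtain ⟨a, b, c, d, h, hc, hc9, rfl⟩ := exists_eq_of_mem_stabInf hpM hx
  obtain ⟨a', b', c', d', h', hc', hc9', rfl⟩ := exists_eq_of_mem_stabInf hpM hy
  have hc9'' : ((p * M : ℕ) : ℤ) ∣ c * a' + d * c' := dvd_add (Dvd.dvd.mul_right hc9 _) (Dvd.dvd.mul_left hc9' _)
  rw [g0Of_mul a b c d a' b' c' d' h hc h' hc' (det_mul_entries h h')
      (dvd_add (Dvd.dvd.mul_right hc _) (Dvd.dvd.mul_left hc' _)),
    restr_g0Of φ _ _ _ _ _ _ hc9'', restr_g0Of φ a b c d h hc hc9, restr_g0Of φ a' b' c' d' h' hc' hc9', ← hadd,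
    g0Of_mul]

/-- **Agreement on `stabZero ∩ stabInf`**: `coshift φ ε = restr φ` there, from the `ε`-eigen-property of `φ`. [folklore] -/
theorem coshift_eq_restr (hpM : ¬ p ∣ M) (hinv : IsShiftEigenP p ε φ) :
    ∀ x ∈ stabZero p M, x ∈ stabInf p M → coshift φ ε x = restr φ x := by
  intro x hx hxB
  obtain ⟨a, b, c, d, h, hc, rfl⟩ := exists_eq_of_mem_stabZero hx
  have hc9 : ((p * M : ℕ) : ℤ) ∣ c := (mem_stabInf_iff hpM).mp hxB
  rw [coshift_g0Of φ ε a b c d h hc (by linear_combination h) (dvd_p_mul' hc),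
    restr_g0Of φ a (p * b) c d h hc hc9, hinv a b c d (by linear_combination h) hc9]

/-- `restr φ` is invariant under conjugation by `stabInf` on `kerAct`. [folklore] -/
theorem restr_conj_of_mem_stabInf (hpM : ¬ p ∣ M) (hadd : IsAdd φ) {g : Gamma0 M} (hg : g ∈ stabInf p M)
    {x : Gamma0 M} (hx : x ∈ kerAct p M) : restr φ (g * x * g⁻¹) = restr φ x := by
  have hxB := stabInf_of_kerAct hx
  rw [restr_add φ hpM hadd _ ((stabInf p M).mul_mem hg hxB) _ ((stabInf p M).inv_mem hg),
    restr_add φ hpM hadd _ hg _ hxB, addOn_map_inv (restr_add φ hpM hadd) hg]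
  abel

/-- `restr φ` is invariant under conjugation by `stabZero` on `kerAct` (via `coshift`). [folklore] -/
theorem restr_conj_of_mem_stabZero (hpM : ¬ p ∣ M) (hadd : IsAdd φ) (hinv : IsShiftEigenP p ε φ)
    {g : Gamma0 M} (hg : g ∈ stabZero p M) {x : Gamma0 M} (hx : x ∈ kerAct p M) :
    restr φ (g * x * g⁻¹) = restr φ x := by
  have hxA := stabZero_of_kerAct hx
  have hgx : g * x * g⁻¹ ∈ kerAct p M := kerAct_conj_mem g hx
  rw [← coshift_eq_restr φ ε hpM hinv _ (stabZero_of_kerAct hgx) (stabInf_of_kerAct hgx),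
    ← coshift_eq_restr φ ε hpM hinv _ hxA (stabInf_of_kerAct hx),
    coshift_add φ ε hadd _ ((stabZero p M).mul_mem hg hxA) _ ((stabZero p M).inv_mem hg),
    coshift_add φ ε hadd _ hg _ hxA, addOn_map_inv (coshift_add φ ε hadd) hg]
  abel

end Pair

/-! ### §2. `Γ₀(M) = ⟨T⟩ · stabZero · ⟨T⟩` pointwise, conjugation invariance of `ρ`, `stabInf = (stabZero ∩ stabInf) · ⟨T⟩` -/

section Decompositions

variable {p : ℕ} [Fact p.Prime] {K : Type*} [CommRing K] {M : ℕ}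

/-- The cast of `j.val` back to `ZMod p` (through `ℤ`). [folklore] -/
theorem intCast_val (j : ZMod p) : (((j.val : ℕ) : ℤ) : ZMod p) = j := by
  rw [Int.cast_natCast, ZMod.natCast_zmod_val]

/-- **`Γ₀(M) = T^v · Stab(0) · T^{−u}` pointwise**: every `g` has `u, v` with `T^{−v} g T^{u} ∈ stabZero`. [folklore] -/
theorem exists_conj_mem_stabZero (g : Gamma0 M) :
    ∃ u v : ZMod p, Tpow M (-((v.val : ℕ) : ℤ)) * g * Tpow M ((u.val : ℕ) : ℤ) ∈ stabZero p M := by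
  obtain ⟨u, v, huv⟩ := exists_act_some_eq_some (p := p) (g : SL(2, ℤ))
  refine ⟨u, v, ?_⟩
  rw [mem_stabZero, Subgroup.coe_mul, Subgroup.coe_mul, act_mul, act_mul, act_Tpow_some, zero_add, intCast_val,
    huv, act_Tpow_some, Int.cast_neg, intCast_val, add_neg_cancel]

variable (φ : Gamma0 (p * M) → K) (ε : K)

/-- **`ρ = restr φ` on `kerAct` is invariant under conjugation by every `g ∈ Γ₀(M)`.** [folklore] -/
theorem restr_conj (hpM : ¬ p ∣ M) (hadd : IsAdd φ) (hinv : IsShiftEigenP p ε φ)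
    (g : Gamma0 M) {x : Gamma0 M} (hx : x ∈ kerAct p M) : restr φ (g * x * g⁻¹) = restr φ x := by
  obtain ⟨u, v, ha⟩ := exists_conj_mem_stabZero (p := p) g
  set a := Tpow M (-((v.val : ℕ) : ℤ)) * g * Tpow M ((u.val : ℕ) : ℤ) with ha_def
  have hg : g = Tpow M ((v.val : ℕ) : ℤ) * a * Tpow M (-((u.val : ℕ) : ℤ)) := by
    rw [ha_def, ← mul_assoc, ← mul_assoc, Tpow_mul_Tpow, add_neg_cancel, Tpow_zero, one_mul, mul_assoc,
      Tpow_mul_Tpow, add_neg_cancel, Tpow_zero, mul_one]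
  have h1 : restr φ (Tpow M (-((u.val : ℕ) : ℤ)) * x * (Tpow M (-((u.val : ℕ) : ℤ)))⁻¹) = restr φ x :=
    restr_conj_of_mem_stabInf φ hpM hadd (Tpow_mem_stabInf _) hx
  set x₁ := Tpow M (-((u.val : ℕ) : ℤ)) * x * (Tpow M (-((u.val : ℕ) : ℤ)))⁻¹ with hx₁
  have hx₁K : x₁ ∈ kerAct p M := kerAct_conj_mem _ hx
  have h2 : restr φ (a * x₁ * a⁻¹) = restr φ x₁ := restr_conj_of_mem_stabZero φ ε hpM hadd hinv ha hx₁K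
  have hx₂K : a * x₁ * a⁻¹ ∈ kerAct p M := kerAct_conj_mem _ hx₁K
  have h3 : restr φ (Tpow M ((v.val : ℕ) : ℤ) * (a * x₁ * a⁻¹) * (Tpow M ((v.val : ℕ) : ℤ))⁻¹) =
      restr φ (a * x₁ * a⁻¹) := restr_conj_of_mem_stabInf φ hpM hadd (Tpow_mem_stabInf _) hx₂K
  have e : g * x * g⁻¹ = Tpow M ((v.val : ℕ) : ℤ) * (a * x₁ * a⁻¹) * (Tpow M ((v.val : ℕ) : ℤ))⁻¹ := by
    rw [hg, hx₁]
    group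
  rw [e, h3, h2, h1]

omit [CommRing K] in
/-- **`stabInf = (stabZero ∩ stabInf) · ⟨T⟩`**: every `b ∈ stabInf` is `c · T^k` with `c ∈ stabZero ∩ stabInf`. [folklore] -/
theorem exists_stab_mul_Tpow {b : Gamma0 M} (hb : b ∈ stabInf p M) :
    ∃ (k : ℤ) (c : Gamma0 M), c ∈ stabZero p M ∧ c ∈ stabInf p M ∧ b = c * Tpow M k := by
  have hc : (p : ℤ) ∣ ((b : SL(2, ℤ)) 1 0 : ℤ) := (act_none_eq_none_iff _).mp hb
  -- `b·[u:1] = [(a u + b₀₁)/d : 1]`; the finite point `j := −b₀₁/a` is mapped to `0`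
  set j : ZMod p := -(ent (p := p) (b : SL(2, ℤ)) 0 1 * (ent (p := p) (b : SL(2, ℤ)) 0 0)⁻¹) with hj
  have hdet := det_ent (p := p) (b : SL(2, ℤ))
  have hc' : ent (p := p) (b : SL(2, ℤ)) 1 0 = 0 := (ent_eq_zero_iff _ 1 0).mpr hc
  rw [hc', mul_zero, sub_zero] at hdet
  have ha : ent (p := p) (b : SL(2, ℤ)) 0 0 ≠ 0 := fun h => by rw [h, zero_mul] at hdet; exact zero_ne_one hdet
  have hbj : act (p := p) (b : SL(2, ℤ)) (some j) = some 0 := by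
    rw [act_some_of_dvd _ hc, hj]
    congr 1
    rw [mul_neg, ← mul_assoc, mul_comm (ent (b : SL(2, ℤ)) 0 0), mul_assoc, mul_inv_cancel₀ ha, mul_one,
      neg_add_cancel, zero_mul]
  refine ⟨-((j.val : ℕ) : ℤ), b * Tpow M ((j.val : ℕ) : ℤ), ?_, ?_, ?_⟩
  · rw [mem_stabZero, Subgroup.coe_mul, act_mul, act_Tpow_some, zero_add, intCast_val, hbj]
  · exact (stabInf p M).mul_mem hb (Tpow_mem_stabInf _)
  · rw [mul_assoc, Tpow_mul_Tpow, add_neg_cancel, Tpow_zero, mul_one]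

end Decompositions

end PShiftTransfer

end Summit.BirchSwinnertonDyer.BirchSwinnertonDyer.Theorems.ManinLocalTwoThree
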